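import Summits.RiemannHypothesis.RiemannHypothesis.Theorems.SemilocalDeletionToeplitzFloorUniform
import HarnessLib

/-!
# The BAND-EDGE LAW of the Toeplitz floor: a finite window never pays the all-window price

`SemilocalDeletionToeplitzFloor.lean` reduced the cost of deleting a prime `p ∈ S` from the semi-local Weil form on a window
`[−c, c]` with `m` visible powers (`2c < (m+1)·log p`) to the fibre certificate `A_m(p) + μ·I ⪰ 0`,
`A_m(p) = log p·(K_{m+1}(ρ) − I)`, `K_n(ρ) = [ρ^{|i−j|}]` the Kac–Murdock–Szegő matrix at `ρ = 1/√p`;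
`SemilocalDeletionToeplitzFloorUniform.lean` proved `K_n(ρ) ⪰ (1−ρ)/(1+ρ)` for EVERY `n` (the KMS symbol
`(1−ρ²)/(1 − 2ρ cos θ + ρ²)` at `θ = π`), i.e. the all-window floor `F_p = 2·log p/(√p + 1)`.  Here the window is kept FINITE:

  `K_{m+1}(ρ) ⪰ (1 − ρ²)/(1 + 2ρ·cos(π/(m+2)) + ρ²)`   (`kms_causal_bandEdge` + reflection),

the KMS symbol at the LAST frequency `θ = (m+1)π/(m+2)` the path on `m+1` vertices admits.  Two elementary ingredients:
(§1) the PATH BOUND `|Σ x_i x_{i+1}| ≤ cos(π/(m+2))·Σ x_i²` (weighted AM–GM with the sine Perron vector), and (§2) the KMS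
DUALITY `xᵀKx + yᵀK⁻¹y ≥ 2⟨x, y⟩` proved with the causal filter of the companion file and the TRIDIAGONAL inverse form
`K⁻¹[y] = [Σ_{i<m}(y_i − ρy_{i+1})² ]/(1−ρ²) + y_m²` (one completed square per index), applied at `y = λ·x`.  Hence (§2–§3):

* `cert_bandEdge`: `A_m(p) ⪰ −F̂_p(m)·I`, `F̂_p(m) = 2·log p·(1 + c_m√p)/(p + 2c_m√p + 1)`, `c_m = cos(π/(m+2))`;
* `re_weilSemilocalQuadratic_erase_ge_bandEdge` / `semilocalGroundEnergy_erase_ge_bandEdge`: on a window with `m` visible powers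
  `Re Q_{S∖{p}}(g) ≥ Re Q_S(g) − F̂_p(m)·‖g‖₂²` and `λ_min(S∖{p}; c; P) ≥ λ_min(S; c; P) − F̂_p(m)`, every `S ∋ p`, every `P`.

`F̂_p(m) ↑ F_p` as `m → ∞` and `F_p − F̂_p(m) = 2·log p·(1 − c_m)·√p(√p − 1)/((√p + 1)(p + 2c_m√p + 1)) ≍ (log p)·m⁻²`: the
single-prime staircase `μ*_p(b)` of HOME/cc-s2-1/gen17/ANIMAL-SUPREMUM.md §9 stays STRICTLY below its limit `F_p` by `≍ b⁻²`
(data, `p = 2`: deficits `7.8e−3, 1.9e−3, 8.7e−4` at `b = 2, 4, 6`; this bound: `≥ 6.0e−3, 1.7e−3, 7.9e−4`).  `p = 2`: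
`F̂ = 0.5545, 0.5621, 0.5660, 0.5682` at `m = 2, 3, 4, 5` vs the sharp `0.5412, 0.5563, 0.5629, 0.5664` and `F_2 = 0.5742`; the
matching lower side `F̌_p(m)` (`F̂ − F̌ = O(m⁻³)`, an explicit comb vector) is the sequel's.  The generic lemmas
(`kms_offdiag_real_of_causal`, `cert_of_causal`) turn ANY causal KMS bound `κ·|x|² ≤ xᵀKx` into a fibre certificate `log p·(1−κ)`.
Nothing here bears on RH; these are statements about truncated Weil forms.
-/

set_option linter.dupNamespace false

noncomputable section

open Complex Filter Set MeasureTheory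
open scoped Real Topology ComplexConjugate

namespace Summit.RiemannHypothesis.RiemannHypothesis.Theorems.SemilocalDeletionToeplitzBandEdge

open Literature.NumberTheory.LFunctions
open Summit.RiemannHypothesis.RiemannHypothesis.Theorems.SemilocalDeletionToeplitzFloor
open Summit.RiemannHypothesis.RiemannHypothesis.Theorems.SemilocalDeletionToeplitzFloorUniform
open Summit.RiemannHypothesis.RiemannHypothesis.Theorems.SemilocalDeletionCliff
open Summit.RiemannHypothesis.RiemannHypothesis.Theorems.HandoffSemilocalEnergy

/-! ## §1  The path bound `|Σ_{i<m} x_i x_{i+1}| ≤ cos(π/(m+2))·Σ_{i≤m} x_i²` (Perron vector of the path = sine weights) -/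

/-- The sine weights `s_i = sin((i+1)π/(m+2))` are positive for `i ≤ m`. -/
private theorem sin_weight_pos {m i : ℕ} (hi : i ≤ m) : 0 < Real.sin ((i + 1) * (π / (m + 2))) := by
  have hm : (0 : ℝ) < m + 2 := by positivity
  apply Real.sin_pos_of_pos_of_lt_pi
  · positivity
  · rw [← mul_div_assoc, div_lt_iff₀ hm]
    have : (i : ℝ) + 1 < m + 2 := by exact_mod_cast (show i + 1 < m + 2 by omega)
    nlinarith [Real.pi_pos]

/-- The three-term recursion of the sine weights: `sin(aθ) + sin((a+2)θ) = 2cos θ·sin((a+1)θ)`. -/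
private theorem sin_weight_rec (θ a : ℝ) :
    Real.sin (a * θ) + Real.sin ((a + 2) * θ) = 2 * Real.cos θ * Real.sin ((a + 1) * θ) := by
  have h := Real.two_mul_sin_mul_cos ((a + 1) * θ) θ
  rw [show (a + 1) * θ - θ = a * θ by ring, show (a + 1) * θ + θ = (a + 2) * θ by ring] at h
  linarith

/-- Weighted AM–GM for one edge: `2|ab| ≤ r·a² + r⁻¹·b²` for `r > 0`. -/
private theorem two_abs_mul_le {r : ℝ} (hr : 0 < r) (a b : ℝ) : 2 * |a * b| ≤ r * a ^ 2 + r⁻¹ * b ^ 2 := by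
  have hid : r * a ^ 2 + r⁻¹ * b ^ 2 - 2 * |a * b| = (r * |a| - |b|) ^ 2 / r := by
    rw [abs_mul]; field_simp; rw [← sq_abs a, ← sq_abs b]; ring
  have : 0 ≤ (r * |a| - |b|) ^ 2 / r := div_nonneg (sq_nonneg _) hr.le
  linarith

/-- **THE PATH BOUND** (largest eigenvalue `2cos(π/(m+2))` of the path on `m+1` vertices): `|Σ_{i<m} x_i x_{i+1}| ≤ cos(π/(m+2))·Σ_{i≤m} x_i²`.
Weighted AM–GM on each edge with the ratios `s_{i+1}/s_i` of the Perron vector `s_i = sin((i+1)π/(m+2))`; the recursion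
`s_{i−1} + s_{i+1} = 2cos(π/(m+2))·s_i` (`s_{−1} = s_{m+1} = 0`) makes every vertex weight `2cos(π/(m+2))` (a telescoping sum). -/
theorem abs_sum_mul_succ_le (m : ℕ) (x : ℕ → ℝ) :
    |∑ i ∈ Finset.range m, x i * x (i + 1)| ≤ Real.cos (π / (m + 2)) * ∑ i ∈ Finset.range (m + 1), x i ^ 2 := by
  set θ : ℝ := π / (m + 2) with hθ
  set c : ℝ := Real.cos θ with hc
  set s : ℕ → ℝ := fun i ↦ Real.sin ((i + 1) * θ) with hs
  have hpos : ∀ i, i ≤ m → 0 < s i := fun i hi ↦ sin_weight_pos hi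
  have hend : s (m + 1) = 0 := by
    have hm : (m : ℝ) + 2 ≠ 0 := by positivity
    simp only [hs]; push_cast
    rw [show ((m : ℝ) + 1 + 1) * θ = π by rw [hθ]; field_simp; ring, Real.sin_pi]
  have hs1 : s 1 = 2 * c * s 0 := by
    have h := sin_weight_rec θ 0
    rw [zero_mul, Real.sin_zero, zero_add] at h
    simp only [hs, hc]
    push_cast
    rw [show ((1 : ℝ) + 1) * θ = (0 + 2) * θ by ring, h, show ((0 : ℝ) + 1) * θ = 1 * θ by ring]
  have hrec : ∀ i : ℕ, s i + s (i + 2) = 2 * c * s (i + 1) := by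
    intro i
    have h := sin_weight_rec θ ((i : ℝ) + 1)
    simp only [hs, hc]
    push_cast
    rw [show ((i : ℝ) + 2 + 1) = ((i : ℝ) + 1 + 2) by ring, h]
  -- the edge ratios `t_i = s_{i+1}/s_i`; `t_0 = 2c`, `t_m = 0`, `1/t_i = 2c − t_{i+1}` for `i < m`
  set t : ℕ → ℝ := fun i ↦ s (i + 1) / s i with ht
  have ht0 : t 0 = 2 * c := by simp only [ht]; rw [div_eq_iff (hpos 0 (Nat.zero_le _)).ne', hs1]
  have htm : t m = 0 := by simp only [ht, hend, zero_div]
  have htpos : ∀ i, i < m → 0 < t i := fun i hi ↦ div_pos (hpos (i + 1) hi) (hpos i hi.le)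
  have hinv : ∀ i, i < m → (t i)⁻¹ = 2 * c - t (i + 1) := by
    intro i hi
    have h1 : 0 < s (i + 1) := hpos (i + 1) hi
    simp only [ht, inv_div]
    rw [div_eq_iff h1.ne', sub_mul, div_mul_cancel₀ _ h1.ne']; linarith [hrec i]
  have hterm : ∀ i ∈ Finset.range m,
      2 * |x i * x (i + 1)| ≤ (t i * x i ^ 2 - t (i + 1) * x (i + 1) ^ 2) + 2 * c * x (i + 1) ^ 2 := by
    intro i hi
    have h := two_abs_mul_le (htpos i (Finset.mem_range.1 hi)) (x i) (x (i + 1))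
    rw [hinv i (Finset.mem_range.1 hi)] at h; linarith
  have hsum := Finset.sum_le_sum hterm
  rw [← Finset.mul_sum, Finset.sum_add_distrib, Finset.sum_range_sub', ← Finset.mul_sum, ht0, htm, zero_mul,
    sub_zero] at hsum
  have habs : |∑ i ∈ Finset.range m, x i * x (i + 1)| ≤ ∑ i ∈ Finset.range m, |x i * x (i + 1)| := Finset.abs_sum_le_sum_abs _ _
  rw [show ∑ i ∈ Finset.range (m + 1), x i ^ 2 = x 0 ^ 2 + ∑ i ∈ Finset.range m, x (i + 1) ^ 2 by
    rw [Finset.sum_range_succ']; ring]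
  linarith

/-- `cos(π/(m+2)) ≥ 0`. -/
theorem cos_weight_nonneg (m : ℕ) : 0 ≤ Real.cos (π / (m + 2)) := by
  have hm : (2 : ℝ) ≤ m + 2 := by linarith [(Nat.cast_nonneg m : (0 : ℝ) ≤ m)]
  refine Real.cos_nonneg_of_neg_pi_div_two_le_of_le ?_ (div_le_div_of_nonneg_left Real.pi_pos.le (by norm_num) hm)
  have : 0 ≤ π / (m + 2) := by positivity
  linarith [Real.pi_pos]

/-! ## §2  KMS duality by the causal filter: `xᵀK_{n+1}(ρ)x + yᵀK_{n+1}(ρ)⁻¹y ≥ 2⟨x, y⟩`, and the band-edge constant -/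

/-- **Causal duality** `xᵀKx + yᵀK⁻¹y ≥ 2⟨x, y⟩`. `0 ≤ ρ < 1`, `v` the causal-filter companion of `x` (`v₀ = 0`, `v_{i+1} = ρ(v_i + x_i)`,
`i < n`; `Σ x_i² + 2Σ x_i v_i = xᵀK_{n+1}(ρ)x`).  For EVERY `y`: `2Σ_{i≤n} x_i y_i − [Σ_{i<n} (y_i − ρ·y_{i+1})²/(1 − ρ²) + y_n²] ≤ Σ x_i² + 2Σ x_i v_i`;
the bracket is the form of the TRIDIAGONAL inverse `K_{n+1}(ρ)⁻¹`; one completed square per index in the coordinates `u = x + v`. -/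
theorem kms_causal_duality {ρ : ℝ} (hρ : 0 ≤ ρ) (hρ1 : ρ < 1) (x v : ℕ → ℝ) (hv0 : v 0 = 0) (n : ℕ)
    (hrec : ∀ i < n, v (i + 1) = ρ * (v i + x i)) (y : ℕ → ℝ) :
    2 * ∑ i ∈ Finset.range (n + 1), x i * y i -
        ((∑ i ∈ Finset.range n, (y i - ρ * y (i + 1)) ^ 2) / (1 - ρ ^ 2) + y n ^ 2) ≤
      ∑ i ∈ Finset.range (n + 1), x i ^ 2 + 2 * ∑ i ∈ Finset.range (n + 1), x i * v i := by
  obtain ⟨h1, -⟩ := causal_filter_aux hρ x v hv0 n hrec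
  rw [h1]
  have hk : 0 < 1 - ρ ^ 2 := by nlinarith
  set u : ℕ → ℝ := fun i ↦ x i + v i with hu
  have hu' : ∀ i, x i + v i = u i := fun i ↦ rfl
  simp only [hu']
  have hx0 : x 0 = u 0 := by simp [hu, hv0]
  have hxs : ∀ i < n, x (i + 1) = u (i + 1) - ρ * u i := fun i hi ↦ by simp only [hu]; rw [hrec i hi]; ring
  -- `⟨x, y⟩ = Σ_{i<n} u_i (y_i − ρ y_{i+1}) + u_n y_n`
  have hxy : ∑ i ∈ Finset.range (n + 1), x i * y i =
      ∑ i ∈ Finset.range n, u i * (y i - ρ * y (i + 1)) + u n * y n := by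
    have hA : ∑ i ∈ Finset.range (n + 1), x i * y i =
        ∑ i ∈ Finset.range n, (u (i + 1) * y (i + 1) - ρ * (u i * y (i + 1))) + u 0 * y 0 := by
      rw [Finset.sum_range_succ', hx0]
      exact congrArg (· + _) (Finset.sum_congr rfl fun i hi ↦ by rw [hxs i (Finset.mem_range.1 hi)]; ring)
    have hB : ∑ i ∈ Finset.range n, u (i + 1) * y (i + 1) + u 0 * y 0 =
        ∑ i ∈ Finset.range n, u i * y i + u n * y n := by
      rw [← Finset.sum_range_succ' (fun i ↦ u i * y i), Finset.sum_range_succ]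
    have hC : ∑ i ∈ Finset.range n, u i * (y i - ρ * y (i + 1)) =
        ∑ i ∈ Finset.range n, u i * y i - ∑ i ∈ Finset.range n, ρ * (u i * y (i + 1)) := by
      rw [← Finset.sum_sub_distrib]; exact Finset.sum_congr rfl fun i _ ↦ by ring
    rw [hA, Finset.sum_sub_distrib, hC]; linarith
  rw [hxy, Finset.sum_range_succ (fun i ↦ u i ^ 2)]
  have hterm : ∀ i ∈ Finset.range n,
      2 * (u i * (y i - ρ * y (i + 1))) - (y i - ρ * y (i + 1)) ^ 2 / (1 - ρ ^ 2) ≤ (1 - ρ ^ 2) * u i ^ 2 := by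
    intro i _
    have h0 : 0 ≤ ((1 - ρ ^ 2) * u i - (y i - ρ * y (i + 1))) ^ 2 / (1 - ρ ^ 2) := div_nonneg (sq_nonneg _) hk.le
    have hid : ((1 - ρ ^ 2) * u i - (y i - ρ * y (i + 1))) ^ 2 / (1 - ρ ^ 2) =
        (1 - ρ ^ 2) * u i ^ 2 - 2 * (u i * (y i - ρ * y (i + 1))) + (y i - ρ * y (i + 1)) ^ 2 / (1 - ρ ^ 2) := by
      field_simp; ring
    linarith
  have hsum := Finset.sum_le_sum hterm
  rw [Finset.sum_sub_distrib, ← Finset.mul_sum, ← Finset.mul_sum, ← Finset.sum_div] at hsum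
  have hlast : 2 * (u n * y n) - y n ^ 2 ≤ (1 - ρ ^ 2) * u n ^ 2 + ρ ^ 2 * u n ^ 2 := by
    nlinarith [sq_nonneg (u n - y n)]
  nlinarith [hsum, hlast]

/-- **THE BAND-EDGE KMS BOUND (causal half).** `v` the causal-filter companion of `x` on `{0,…,n}`, `0 ≤ ρ < 1`:
`λ_n·Σ x_i² ≤ Σ x_i² + 2Σ x_i v_i`, `λ_n = (1 − ρ²)/(1 + 2ρ·cos(π/(n+2)) + ρ²)` = the KMS symbol at the LAST frequency `(n+1)π/(n+2)`
of the path (at `θ = π` it is the all-`n` constant `(1−ρ)/(1+ρ)` of `kms_causal_lower`).  Duality at `y = λ_n·x` and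
`K⁻¹[x]·(1−ρ²) ≤ (1 + ρ²)|x|² − 2ρ·Σ x_i x_{i+1} ≤ (1 + 2ρ cos(π/(n+2)) + ρ²)|x|²` by the path bound. -/
theorem kms_causal_bandEdge {ρ : ℝ} (hρ : 0 ≤ ρ) (hρ1 : ρ < 1) (x v : ℕ → ℝ) (hv0 : v 0 = 0) (n : ℕ)
    (hrec : ∀ i < n, v (i + 1) = ρ * (v i + x i)) :
    (1 - ρ ^ 2) / (1 + 2 * ρ * Real.cos (π / (n + 2)) + ρ ^ 2) * ∑ i ∈ Finset.range (n + 1), x i ^ 2 ≤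
      ∑ i ∈ Finset.range (n + 1), x i ^ 2 + 2 * ∑ i ∈ Finset.range (n + 1), x i * v i := by
  set c := Real.cos (π / (n + 2)) with hc
  have hc0 : 0 ≤ c := cos_weight_nonneg n
  set D := 1 + 2 * ρ * c + ρ ^ 2 with hD
  have h2ρc : 0 ≤ 2 * ρ * c := by positivity
  have hD0 : 0 < D := by rw [hD]; nlinarith [sq_nonneg ρ]
  have hk : 0 < 1 - ρ ^ 2 := by nlinarith
  set lam := (1 - ρ ^ 2) / D with hlam
  have hlam0 : 0 ≤ lam := div_nonneg hk.le hD0.le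
  set N := ∑ i ∈ Finset.range (n + 1), x i ^ 2 with hN
  set P := ∑ i ∈ Finset.range n, x i * x (i + 1) with hP
  set Sq := ∑ i ∈ Finset.range n, (x i - ρ * x (i + 1)) ^ 2 with hSq
  have hpath : |P| ≤ c * N := abs_sum_mul_succ_le n x
  have hQ : Sq + (1 - ρ ^ 2) * x n ^ 2 ≤ D * N := by
    have e1 : ∑ i ∈ Finset.range n, x i ^ 2 + x n ^ 2 = N := (Finset.sum_range_succ (fun i ↦ x i ^ 2) n).symm
    have e2 : ∑ i ∈ Finset.range n, x (i + 1) ^ 2 + x 0 ^ 2 = N := (Finset.sum_range_succ' (fun i ↦ x i ^ 2) n).symm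
    have e3 : Sq = ∑ i ∈ Finset.range n, x i ^ 2 - 2 * ρ * P + ρ ^ 2 * ∑ i ∈ Finset.range n, x (i + 1) ^ 2 := by
      simp only [hSq, hP, Finset.mul_sum, ← Finset.sum_sub_distrib, ← Finset.sum_add_distrib]
      exact Finset.sum_congr rfl fun i _ ↦ by ring
    have hPle : -P ≤ c * N := by linarith [neg_abs_le P]
    nlinarith [mul_nonneg hρ (by linarith [hPle] : 0 ≤ c * N + P), mul_nonneg (sq_nonneg ρ) (sq_nonneg (x 0)),
      mul_nonneg (sq_nonneg ρ) (sq_nonneg (x n))]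
  have hdual := kms_causal_duality hρ hρ1 x v hv0 n hrec (fun i ↦ lam * x i)
  have ey : ∑ i ∈ Finset.range (n + 1), x i * (lam * x i) = lam * N := by
    rw [hN, Finset.mul_sum]; exact Finset.sum_congr rfl fun i _ ↦ by ring
  have eS : ∑ i ∈ Finset.range n, (lam * x i - ρ * (lam * x (i + 1))) ^ 2 = lam ^ 2 * Sq := by
    rw [hSq, Finset.mul_sum]; exact Finset.sum_congr rfl fun i _ ↦ by ring
  rw [ey, eS] at hdual
  have hmul := mul_le_mul_of_nonneg_left hQ (by positivity : 0 ≤ lam ^ 2 / (1 - ρ ^ 2))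
  have e4 : lam ^ 2 / (1 - ρ ^ 2) * (D * N) = lam * N := by rw [hlam]; field_simp
  have e5 : lam ^ 2 / (1 - ρ ^ 2) * (Sq + (1 - ρ ^ 2) * x n ^ 2) = lam ^ 2 * Sq / (1 - ρ ^ 2) + (lam * x n) ^ 2 := by
    field_simp
  rw [e4, e5] at hmul
  linarith

/-- **Anticausal half by reflection** (`i ↦ n − i`): a causal bound `κ·Σ x_i² ≤ Σ x_i² + 2Σ x_i v_i` for all `x` gives the same
bound with the ANTICAUSAL companion `t` (`t_n = 0`, `t_i = ρ(t_{i+1} + x_{i+1})`). -/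
theorem kms_anticausal_of_causal {ρ κ : ℝ} (n : ℕ)
    (hcausal : ∀ x v : ℕ → ℝ, v 0 = 0 → (∀ i < n, v (i + 1) = ρ * (v i + x i)) →
      κ * ∑ i ∈ Finset.range (n + 1), x i ^ 2 ≤
        ∑ i ∈ Finset.range (n + 1), x i ^ 2 + 2 * ∑ i ∈ Finset.range (n + 1), x i * v i)
    (x t : ℕ → ℝ) (htn : t n = 0) (hrec : ∀ i < n, t i = ρ * (t (i + 1) + x (i + 1))) :
    κ * ∑ i ∈ Finset.range (n + 1), x i ^ 2 ≤
      ∑ i ∈ Finset.range (n + 1), x i ^ 2 + 2 * ∑ i ∈ Finset.range (n + 1), x i * t i := by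
  have h := hcausal (fun i ↦ x (n - i)) (fun i ↦ t (n - i)) (by simp [htn]) (by
    intro i hi
    have := hrec (n - (i + 1)) (by omega)
    rw [show n - (i + 1) + 1 = n - i by omega] at this
    simpa using this)
  have hx : ∑ i ∈ Finset.range (n + 1), x (n - i) ^ 2 = ∑ i ∈ Finset.range (n + 1), x i ^ 2 :=
    Finset.sum_range_reflect (fun i ↦ x i ^ 2) (n + 1)
  have hxt : ∑ i ∈ Finset.range (n + 1), x (n - i) * t (n - i) = ∑ i ∈ Finset.range (n + 1), x i * t i :=
    Finset.sum_range_reflect (fun i ↦ x i * t i) (n + 1)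
  simpa [hx, hxt] using h

/-- **Two-sided real fibre form from a causal bound** (average of a causal and an anticausal copy, as in `kms_offdiag_real`): for
`x : ℤ → ℝ` supported in `{0,…,m}`, `0 ≤ (1 − κ)·Σ_i x_i² + Σ_{e<m} ρ^{e+1}·Σ_i (x_i x_{i−e−1} + x_i x_{i+e+1})`. -/
theorem kms_offdiag_real_of_causal {ρ κ : ℝ} (m : ℕ)
    (hcausal : ∀ x v : ℕ → ℝ, v 0 = 0 → (∀ i < m, v (i + 1) = ρ * (v i + x i)) →
      κ * ∑ i ∈ Finset.range (m + 1), x i ^ 2 ≤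
        ∑ i ∈ Finset.range (m + 1), x i ^ 2 + 2 * ∑ i ∈ Finset.range (m + 1), x i * v i)
    (x : ℤ → ℝ) (hx1 : ∀ n : ℤ, n < 0 → x n = 0) (hx2 : ∀ n : ℤ, (m : ℤ) < n → x n = 0) :
    0 ≤ (1 - κ) * ∑ i ∈ Finset.range (m + 1), x i ^ 2 +
      ∑ e ∈ Finset.range m, ρ ^ (e + 1) *
        ∑ i ∈ Finset.range (m + 1), (x i * x ((i : ℤ) - (e + 1)) + x i * x ((i : ℤ) + (e + 1))) := by
  set v : ℕ → ℝ := fun i ↦ ∑ e ∈ Finset.range m, ρ ^ (e + 1) * x ((i : ℤ) - (e + 1)) with hvdef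
  set t : ℕ → ℝ := fun i ↦ ∑ e ∈ Finset.range m, ρ ^ (e + 1) * x ((i : ℤ) + (e + 1)) with htdef
  have hsplit : ∑ e ∈ Finset.range m, ρ ^ (e + 1) *
        ∑ i ∈ Finset.range (m + 1), (x i * x ((i : ℤ) - (e + 1)) + x i * x ((i : ℤ) + (e + 1))) =
      ∑ i ∈ Finset.range (m + 1), x i * v i + ∑ i ∈ Finset.range (m + 1), x i * t i := by
    have hA : ∑ e ∈ Finset.range m, ρ ^ (e + 1) * ∑ i ∈ Finset.range (m + 1), x i * x ((i : ℤ) - (e + 1)) =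
        ∑ i ∈ Finset.range (m + 1), x i * v i := by
      simp only [hvdef, Finset.mul_sum]
      rw [Finset.sum_comm]; exact Finset.sum_congr rfl fun i _ ↦ Finset.sum_congr rfl fun e _ ↦ by ring
    have hB : ∑ e ∈ Finset.range m, ρ ^ (e + 1) * ∑ i ∈ Finset.range (m + 1), x i * x ((i : ℤ) + (e + 1)) =
        ∑ i ∈ Finset.range (m + 1), x i * t i := by
      simp only [htdef, Finset.mul_sum]
      rw [Finset.sum_comm]; exact Finset.sum_congr rfl fun i _ ↦ Finset.sum_congr rfl fun e _ ↦ by ring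
    rw [← hA, ← hB, ← Finset.sum_add_distrib]
    exact Finset.sum_congr rfl fun e _ ↦ by rw [Finset.sum_add_distrib, mul_add]
  rw [hsplit]
  have hv0 : v 0 = 0 := by
    simp only [hvdef]
    exact Finset.sum_eq_zero fun e _ ↦ by rw [hx1 _ (by push_cast; omega), mul_zero]
  have hvrec : ∀ i < m, v (i + 1) = ρ * (v i + x i) := by
    intro i hi
    obtain ⟨k, rfl⟩ := Nat.exists_eq_succ_of_ne_zero (by omega : m ≠ 0)
    have hz : x ((i : ℤ) - ((k : ℕ) + 1)) = 0 := hx1 _ (by omega)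
    simp only [hvdef]
    rw [Finset.sum_range_succ', Finset.sum_range_succ, hz, mul_zero, add_zero, mul_add, Finset.mul_sum]
    congr 1
    · refine Finset.sum_congr rfl fun e _ ↦ ?_
      rw [show (((i + 1 : ℕ) : ℤ) - (((e + 1 : ℕ) : ℤ) + 1)) = (i : ℤ) - ((e : ℤ) + 1) by push_cast; ring]; ring
    · rw [show (((i + 1 : ℕ) : ℤ) - (((0 : ℕ) : ℤ) + 1)) = (i : ℤ) by push_cast; ring]; ring
  have htm : t m = 0 := by
    simp only [htdef]
    exact Finset.sum_eq_zero fun e _ ↦ by rw [hx2 _ (by omega), mul_zero]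
  have htrec : ∀ i < m, t i = ρ * (t (i + 1) + x (i + 1)) := by
    intro i hi
    obtain ⟨k, rfl⟩ := Nat.exists_eq_succ_of_ne_zero (by omega : m ≠ 0)
    have hz : x (((i + 1 : ℕ) : ℤ) + ((k : ℕ) + 1)) = 0 := hx2 _ (by push_cast; omega)
    simp only [htdef]
    rw [Finset.sum_range_succ', Finset.sum_range_succ, hz, mul_zero, add_zero, mul_add, Finset.mul_sum]
    congr 1
    · refine Finset.sum_congr rfl fun e _ ↦ ?_
      rw [show ((i : ℤ) + (((e + 1 : ℕ) : ℤ) + 1)) = ((i + 1 : ℕ) : ℤ) + ((e : ℤ) + 1) by push_cast; ring]; ring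
    · rw [show ((i : ℤ) + (((0 : ℕ) : ℤ) + 1)) = (i : ℤ) + 1 by push_cast; ring]; ring
  have hc := hcausal (fun i : ℕ ↦ x i) v hv0 hvrec
  have ha := kms_anticausal_of_causal m hcausal (fun i : ℕ ↦ x i) t htm htrec
  linarith

/-- **Complex fibre certificate from a causal bound** (`ρ = 1/√p`): `A_m(p) ⪰ −log p·(1 − κ)·I` — for `G : ℤ → ℂ` supported in
`{0,…,m}`, `0 ≤ log p·(1 − κ)·Σ‖G_i‖² + Σ_{e<m} (log p/√(p^{e+1}))·Σ_i Re(G_i Ḡ_{i−e−1} + G_i Ḡ_{i+e+1})`. -/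
theorem cert_of_causal {p : ℕ} (hp : p.Prime) (m : ℕ) {κ : ℝ}
    (hcausal : ∀ x v : ℕ → ℝ, v 0 = 0 → (∀ i < m, v (i + 1) = (Real.sqrt p)⁻¹ * (v i + x i)) →
      κ * ∑ i ∈ Finset.range (m + 1), x i ^ 2 ≤
        ∑ i ∈ Finset.range (m + 1), x i ^ 2 + 2 * ∑ i ∈ Finset.range (m + 1), x i * v i)
    (G : ℤ → ℂ) (hG1 : ∀ n : ℤ, n < 0 → G n = 0) (hG2 : ∀ n : ℤ, (m : ℤ) < n → G n = 0) :
    0 ≤ Real.log p * (1 - κ) * ∑ i ∈ Finset.range (m + 1), ‖G i‖ ^ 2 +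
      ∑ e ∈ Finset.range m, Real.log p / Real.sqrt ((p : ℝ) ^ (e + 1)) *
        ∑ i ∈ Finset.range (m + 1), (G i * conj (G ((i : ℤ) - (e + 1))) + G i * conj (G ((i : ℤ) + (e + 1)))).re := by
  have hp0 : (0 : ℝ) < p := by exact_mod_cast hp.pos
  have hL : 0 ≤ Real.log p := Real.log_nonneg (by exact_mod_cast hp.one_lt.le)
  have hs0 : 0 < Real.sqrt p := Real.sqrt_pos.2 hp0
  set ρ : ℝ := (Real.sqrt p)⁻¹ with hρdef
  have hw : ∀ e : ℕ, Real.log p / Real.sqrt ((p : ℝ) ^ (e + 1)) = Real.log p * ρ ^ (e + 1) := by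
    intro e
    have : Real.sqrt ((p : ℝ) ^ (e + 1)) = Real.sqrt p ^ (e + 1) := by
      rw [show ((p : ℝ) ^ (e + 1)) = (Real.sqrt p ^ (e + 1)) ^ 2 by
        rw [← pow_mul, mul_comm, pow_mul, Real.sq_sqrt hp0.le], Real.sqrt_sq (pow_nonneg hs0.le _)]
    rw [this, hρdef, inv_pow, div_eq_mul_inv]
  have hre := kms_offdiag_real_of_causal m hcausal (fun n ↦ (G n).re) (by simp_all) (by simp_all)
  have him := kms_offdiag_real_of_causal m hcausal (fun n ↦ (G n).im) (by simp_all) (by simp_all)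
  have hnorm : ∀ i : ℕ, ‖G i‖ ^ 2 = (G i).re ^ 2 + (G i).im ^ 2 := fun i ↦ by
    rw [Complex.sq_norm, Complex.normSq_apply]; ring
  have hprod : ∀ a b : ℤ, (G a * conj (G b)).re = (G a).re * (G b).re + (G a).im * (G b).im := fun a b ↦ by
    simp only [Complex.mul_re, Complex.conj_re, Complex.conj_im]; ring
  have hsum := mul_nonneg hL (add_nonneg hre him)
  simp only [hw, hnorm, Complex.add_re, hprod]
  simp only [Finset.mul_sum, mul_add, Finset.sum_add_distrib] at hsum ⊢
  simp only [mul_assoc] at hsum ⊢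
  simp only [← Finset.mul_sum] at hsum ⊢
  linarith

/-- **THE BAND-EDGE FIBRE CERTIFICATE.** For every prime `p` and every `m` (`c_m = cos(π/(m+2))`): `A_m(p) ⪰ −F̂_p(m)·I`,
`F̂_p(m) = 2·log p·(1 + c_m√p)/(p + 2c_m√p + 1)` — the fibre hypothesis of `re_weilSemilocalQuadratic_erase_ge_of_cert`.
`F̂_p(m) ↑ 2·log p/(√p + 1)` (the constant of `cert_uniform`) as `m → ∞`, STRICTLY below it at every finite `m`. -/
theorem cert_bandEdge {p : ℕ} (hp : p.Prime) (m : ℕ) (G : ℤ → ℂ) (hG1 : ∀ n : ℤ, n < 0 → G n = 0)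
    (hG2 : ∀ n : ℤ, (m : ℤ) < n → G n = 0) :
    0 ≤ 2 * Real.log p * (1 + Real.cos (π / (m + 2)) * Real.sqrt p) /
          (p + 2 * Real.cos (π / (m + 2)) * Real.sqrt p + 1) * ∑ i ∈ Finset.range (m + 1), ‖G i‖ ^ 2 +
      ∑ e ∈ Finset.range m, Real.log p / Real.sqrt ((p : ℝ) ^ (e + 1)) *
        ∑ i ∈ Finset.range (m + 1), (G i * conj (G ((i : ℤ) - (e + 1))) + G i * conj (G ((i : ℤ) + (e + 1)))).re := by
  have hp0 : (0 : ℝ) < p := by exact_mod_cast hp.pos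
  have hp1 : (1 : ℝ) < p := by exact_mod_cast hp.one_lt
  have hs1 : 1 < Real.sqrt p := by
    rw [show (1 : ℝ) = Real.sqrt 1 by simp]
    exact Real.sqrt_lt_sqrt zero_le_one hp1
  have hs0 : 0 < Real.sqrt p := by linarith
  set ρ : ℝ := (Real.sqrt p)⁻¹ with hρdef
  set c := Real.cos (π / (m + 2)) with hc
  have hc0 : 0 ≤ c := cos_weight_nonneg m
  have h := cert_of_causal hp m (κ := (1 - ρ ^ 2) / (1 + 2 * ρ * c + ρ ^ 2))
    (fun x v hv0 hrec ↦ kms_causal_bandEdge (inv_nonneg.mpr hs0.le) (inv_lt_one_of_one_lt₀ hs1) x v hv0 m hrec) G hG1 hG2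
  have hsq : Real.sqrt p ^ 2 = p := Real.sq_sqrt hp0.le
  have h2ρc : 0 ≤ 2 * ρ * c := by positivity
  have hD : 0 < 1 + 2 * ρ * c + ρ ^ 2 := by nlinarith [sq_nonneg ρ]
  have h2c : 0 ≤ 2 * c * Real.sqrt p := by positivity
  have hD' : 0 < (p : ℝ) + 2 * c * Real.sqrt p + 1 := by nlinarith
  have hconst : Real.log p * (1 - (1 - ρ ^ 2) / (1 + 2 * ρ * c + ρ ^ 2)) =
      2 * Real.log p * (1 + c * Real.sqrt p) / (p + 2 * c * Real.sqrt p + 1) := by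
    set L := Real.log (p : ℝ) with hLdef
    set r := Real.sqrt (p : ℝ) with hrdef
    have hpr : (p : ℝ) = r ^ 2 := hsq.symm
    have hr0 : r ≠ 0 := hs0.ne'
    have hDr : r ^ 2 + 2 * c * r + 1 ≠ 0 := by rw [← hpr]; exact hD'.ne'
    have hDρ : 1 + 2 * ρ * c + ρ ^ 2 ≠ 0 := hD.ne'
    rw [hpr]
    rw [hρdef] at hDρ ⊢
    field_simp
    ring
  rw [hconst] at h
  exact h


/-! ## §3  The band-edge floor on a window -/

variable {g : ℝ → ℂ}

/-- **BAND-EDGE DELETION FLOOR, `Q`-form.** `p ∈ S` prime, `tsupport g ⊆ [−c, c]`, `2c < (m+1)·log p` (at most the powers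
`p, …, p^m` are visible).  Then `Re Q_{S∖{p}}(g) ≥ Re Q_S(g) − F̂_p(m)·‖g‖₂²` with
`F̂_p(m) = 2·log p·(1 + c_m√p)/(p + 2c_m√p + 1)`, `c_m = cos(π/(m+2))` — strictly below the all-window `2·log p/(√p + 1)`. -/
theorem re_weilSemilocalQuadratic_erase_ge_bandEdge (hg : IsWeilTest g) {S : Finset ℕ} {p : ℕ} (hp : p.Prime)
    (hpS : p ∈ S) {c : ℝ} (hsupp : tsupport g ⊆ Icc (-c) c) {m : ℕ} (hm : 2 * c < (m + 1) * Real.log p) :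
    (weilSemilocalQuadratic S g).re -
        2 * Real.log p * (1 + Real.cos (π / (m + 2)) * Real.sqrt p) / (p + 2 * Real.cos (π / (m + 2)) * Real.sqrt p + 1) *
          ∫ u : ℝ, ‖g u‖ ^ 2 ≤
      (weilSemilocalQuadratic (S.erase p) g).re :=
  re_weilSemilocalQuadratic_erase_ge_of_cert hg hp hpS hsupp hm fun G hG1 hG2 ↦ cert_bandEdge hp m G hG1 hG2

variable {P : (ℝ → ℂ) → Prop}

/-- **BAND-EDGE DELETION FLOOR for the bottoms.** `p ∈ S` prime, `2c < (m+1)·log p`: for every constraint `P`,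
`λ_min(S∖{p}; c; P) ≥ λ_min(S; c; P) − F̂_p(m)`.  (`p = 2`: `F̂ = 0.5545, 0.5621, 0.5656, 0.5682` at `m = 2, 3, 4, 5` against the
sharp `0.5412, 0.5563, 0.5629, 0.5664` and the all-window `0.5742`.) -/
theorem semilocalGroundEnergy_erase_ge_bandEdge {S : Finset ℕ} {p : ℕ} (hp : p.Prime) (hpS : p ∈ S) {c : ℝ} {m : ℕ}
    (hm : 2 * c < (m + 1) * Real.log p) :
    semilocalGroundEnergy S P c -
        2 * Real.log p * (1 + Real.cos (π / (m + 2)) * Real.sqrt p) / (p + 2 * Real.cos (π / (m + 2)) * Real.sqrt p + 1) ≤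
      semilocalGroundEnergy (S.erase p) P c := by
  have h1 : 0 ≤ Real.cos (π / (m + 2)) * Real.sqrt p := mul_nonneg (cos_weight_nonneg m) (Real.sqrt_nonneg _)
  have h2 : 0 ≤ 2 * Real.cos (π / (m + 2)) * Real.sqrt p := by linarith
  have hL : 0 ≤ Real.log p := Real.log_natCast_nonneg p
  exact semilocalGroundEnergy_erase_ge_of_cert hp hpS hm (by positivity) fun G hG1 hG2 ↦ cert_bandEdge hp m G hG1 hG2

end Summit.RiemannHypothesis.RiemannHypothesis.Theorems.SemilocalDeletionToeplitzBandEdge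

end
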